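import Literature.MathematicalPhysics.QuantumLattice.HubbardTTPrimeThermalStatesEntropyDensity
import Literature.MathematicalPhysics.QuantumLattice.HubbardTTPrimeOpenBoxGrandCanonicalPressureBound
import Literature.MathematicalPhysics.QuantumLattice.LayeredSystemPartitionFunction
import Literature.MathematicalPhysics.QuantumLattice.TorusSectorPartitionFnTiling
import HarnessLib

/-!
# The EXACT grand-canonical cluster floor: `log Re Ξ^open_ℓ(β; t,t',U; μ,h) ≤ ℓ² · P(β; t,t',U; μ,h)`

Topic `Literature/MathematicalPhysics/QuantumLattice` (family `hubbard`). The grand-canonical, every-`ℓ` cluster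
variational principle WITHOUT the sector-counting loss: `HubbardTTPrimeOpenBoxGrandCanonicalPressureBound` proved
`log Re Ξ^open_ℓ ≤ ℓ²·P + 2 log(ℓ²+1)` by keeping ONE sector term of the torus' grand-canonical sum per box sector
(the `(ℓ²+1)²` sector terms of `Ξ^open_ℓ` then cost `2 log(ℓ²+1)`); here the graded PRODUCT of the open-box
grand-canonical Gibbs states is used as one trial density matrix of the torus (Gibbs–Bogoliubov / Peierls–Bogoliubov),
which is exact:

* §1 (generic, any finite site types, any family of legs `φ_k : Λ₂ ↪ Λ₃` TILING `Λ₃`, any bond graph `G` on `Λ₃` whose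
  restriction to every leg is one graph `G₂` on `Λ₂`): the Hubbard Hamiltonian of `G` is the DECOUPLED sum of the leg
  Hamiltonians of `G₂` plus the SEAM HOPPING (all bonds of `G` joining two different legs):
  `hamiltonian_eq_decoupledSum_add_seamHopping`; the particle number and the spin imbalance are decoupled sums
  (`totalNumber_eq_decoupledSum`, `spinImbalance_eq_decoupledSum`); **the seam hopping has ZERO expectation in the
  decoupled Gibbs state** (`gibbsState_decoupledSum_seamHopping`: every seam word is odd on one leg,
  `LayeredSystemPartitionFunction.gibbsState_decoupledSum_fermionEmbed_mul_fermionEmbed`).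
* §2 (the `K_x a × K_y b` rectangular torus cut into its `K_x K_y` open `a × b` boxes, `K_x, K_y ≥ 2`): the block legs
  `blockLeg` (the tree's `blockEmb`), the tiling equivalence, and
  `hubbardRectTorusTT'_gc_eq_decoupledSum_add_seam`:
  `H^torus − μN − hM = Σ_{ij} Γ_{ij}(H^open_{a×b} − μN − hM) + (seam_t + seam_{t'})`; hence, by Bogoliubov's tangent
  inequality `log Z(H₀ + W) ≥ log Z(H₀) − β⟨W⟩_{H₀} = log Z(H₀)` and `Z(Σ_{ij} Γ_{ij} K) = Z(K)^{K_x K_y}`: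
  **`mul_log_partitionFn_openBox_gc_le_rectTorus_gc`: `K_x K_y · log Re Ξ^open_{a×b} ≤ log Re Ξ^torus_{K_x a × K_y b}`**
  for EVERY real `β`, every `t, t', U, μ, h` (finite volume, no sign condition).
* §3 (thermodynamic limit along `L = Kℓ`, `β ≥ 0`, `U ≥ 0`, `ℓ ≥ 1`):
  **`log_partitionFn_openBox_gc_le_sq_mul_gcPressure`: `log Re Ξ^open_ℓ ≤ ℓ² · gcPressureTT'Zeeman β t t' U μ h`** and the
  same for the local grand-canonical Hamiltonian of `[0,ℓ)² ⊂ ℤ²` (`log_partitionFn_gcLocalHamiltonianTT'_halfOpenBox_le_sq_mul`).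
* §4 consequence for the Gibbs variational principle in the thermodynamic limit
  (`HubbardTTPrimeThermalStatesEntropyDensity`): for every translation-invariant state `ω` and every `ℓ ≥ 1`,
  **`S(ω_{[0,ℓ)²}) ≤ ℓ²·(P + β·u(ω)) + β(8|t|+16|t'|)ℓ`** (`IsTranslationInvariant.vonNeumannEntropy_rdm_halfOpenBox_le_sharp`;
  the `2 log(ℓ²+1)` term of `…_halfOpenBox_le` is gone) and per site `S/ℓ² ≤ P + βu(ω) + β(8|t|+16|t'|)/ℓ`.

READING: an exactly evaluated (or certified from below) open-box grand-canonical partition function at `(β, μ, h)` is a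
FLOOR `ℓ⁻² log Re Ξ^open_ℓ ≤ P` on the thermodynamic pressure with no correction term; at `ℓ = 3` the removed term
`2 log 10 / 9 ≈ 0.51` per site exceeds typical certified pressure-window widths. Everything is PROVED; definitions with
bodies: `seamHopping`, `blockLeg`, `blockTilingEquiv`; no named fact, no number.

## Mathlib / tree search

REUSED: `decoupledSum`, `isHermitian_decoupledSum`, `log_partitionFn_decoupledSum`,
`gibbsState_decoupledSum_fermionEmbed_mul_fermionEmbed`, `log_partitionFn_add_mem_Icc_of_gibbsState_eq_zero`
(`LayeredSystemPartitionFunction`); `blockEmb`, `rectBoxGraph`, `rectBoxDiagGraph`, `hubbardOpenBoxTT'`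
(`HubbardNNNHoppingOpenClusters`), `comap_blockEmb_fermionRectTorusGraph'`, `comap_blockEmb_fermionRectTorusDiagGraph'`
(`TorusSectorPartitionFnTiling`); `hubbardRectTorusTT'`, `card_rectSites`; `parityAut_eq_self_of_preservesSectors`,
`parityAut_totalNumber`, `preservesSectors_hamiltonian`; `partitionFn_gcTorusHamiltonianTT'_re_eq_rect`,
`tendsto_log_partitionFn_gcTorus_div_sq_comp` (`HubbardTTPrimeGrandCanonicalGibbsMixture`);
`partitionFn_gcLocalHamiltonianTT'_halfOpenBox`, `gcLocalHamiltonianTT'_isHermitian` (`…OpenBoxGrandCanonicalPressureBound`);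
`IsHermitian.vonNeumannEntropy_sub_mul_le_log_partitionFn`, `trace_rdm_mul`,
`IsTranslationInvariant.re_expect_gcLocalHamiltonianTT'_halfOpenBox_le` (`…ThermalStatesEntropyDensity`).
`lean search 'openBox.*gcPressure|seamHopping|cluster.*floor'` (2026-08-27): only the `+ 2 log(ℓ²+1)` form of
`HubbardTTPrimeOpenBoxGrandCanonicalPressureBound`; the canonical product bound `prod_partitionFn_openBox_le_rectTorus`
(one sector assignment at a time) cannot give the grand-canonical statement (summing over assignments overcounts the
torus sectors), hence the Peierls–Bogoliubov route here.

## References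

* D. Ruelle, *Statistical Mechanics: Rigorous Results* (1969), §2.5 (Peierls–Bogoliubov), §3.4 (the grand-canonical
  pressure and sub-boxes). [cite: Ruelle1969, §3.4]
* R. B. Israel, *Convexity in the Theory of Lattice Gases* (1979), Lemma II.3.1 (free vs periodic boundary conditions).
  [cite: Israel1979, Lemma II.3.1]
* E. H. Lieb, CMP 31 (1973) 327, §V eqs. (5.2)–(5.4) (the Peierls–Bogoliubov bracket). [cite: Lieb1973, §V eqs. (5.2)–(5.4)]
* B. Simon, *The Statistical Mechanics of Lattice Gases* I (1993), §II.8. [cite: Simon1993, §II.8]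
-/

noncomputable section

namespace Literature.MathematicalPhysics.QuantumLattice

open Matrix Finset HubbardWave0 Literature.Probability.LatticeModels ThermodynamicLimit LiebThm1
open _root_.Filter
open scoped _root_.Topology ComplexOrder BigOperators

/-! ### §1 Legs tiling a site type: decoupled sum plus seam hopping -/

section Seam

variable {Λ₂ Λ₃ : Type*} [LinearOrder Λ₂] [Fintype Λ₂] [LinearOrder Λ₃] [Fintype Λ₃]
  {K : Type*} [Fintype K] [DecidableEq K] (φ : K → (Λ₂ ↪ Λ₃))

omit [DecidableEq K] in
/-- The decoupled sum is additive in the leg Hamiltonian. [cite: BratteliRobinsonII1997, §5.2.2] -/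
theorem decoupledSum_add (X Y : Matrix (Finset (Orb Λ₂)) (Finset (Orb Λ₂)) ℂ) :
    decoupledSum φ (X + Y) = decoupledSum φ X + decoupledSum φ Y := by
  simp only [decoupledSum, map_add, Finset.sum_add_distrib]

omit [DecidableEq K] in
/-- The decoupled sum is homogeneous in the leg Hamiltonian. [cite: BratteliRobinsonII1997, §5.2.2] -/
theorem decoupledSum_smul (c : ℂ) (X : Matrix (Finset (Orb Λ₂)) (Finset (Orb Λ₂)) ℂ) :
    decoupledSum φ (c • X) = c • decoupledSum φ X := by
  simp only [decoupledSum, map_smul, Finset.smul_sum]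

omit [DecidableEq K] in
/-- The decoupled sum of a difference. [cite: BratteliRobinsonII1997, §5.2.2] -/
theorem decoupledSum_sub (X Y : Matrix (Finset (Orb Λ₂)) (Finset (Orb Λ₂)) ℂ) :
    decoupledSum φ (X - Y) = decoupledSum φ X - decoupledSum φ Y := by
  simp only [decoupledSum, map_sub, Finset.sum_sub_distrib]

/-- **The seam hopping** of a bond graph `G` on `Λ₃` relative to the legs `φ_k`: all (ordered) bonds of `G` joining two
DIFFERENT legs, `−t Σ_{k ≠ j} Σ_{x,y} Σ_σ [φ_k x ∼ φ_j y] c†_{φ_k x,σ} c_{φ_j y,σ}` (the bonds cut when a torus is divided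
into open boxes). [cite: Ruelle1969, §3.4] -/
def seamHopping (G : SimpleGraph Λ₃) [DecidableRel G.Adj] (t : ℝ) : Matrix (Finset (Orb Λ₃)) (Finset (Orb Λ₃)) ℂ :=
  -(t : ℂ) • ∑ k : K, ∑ x : Λ₂, ∑ j : K, ∑ y : Λ₂, ∑ σ : Fin 2,
    if k ≠ j ∧ G.Adj (φ k x) (φ j y) then creation (orb (φ k x) σ) * annihilation (orb (φ j y) σ) else 0

omit [LinearOrder Λ₂] [LinearOrder Λ₃] [DecidableEq K] in
/-- Sums over a site type tiled by legs: `Σ_p f(p) = Σ_k Σ_x f(φ_k x)` when `(k, x) ↦ φ_k x` is a bijection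
(bookkeeping for the cluster decomposition). [cite: Ruelle1969, §3.4] -/
theorem sum_eq_sum_sum_legs (e : K × Λ₂ ≃ Λ₃) (he : ∀ k x, e (k, x) = φ k x) {M : Type*} [AddCommMonoid M]
    (f : Λ₃ → M) : ∑ p, f p = ∑ k, ∑ x, f (φ k x) := by
  rw [← e.sum_comp, Fintype.sum_prod_type]
  simp_rw [he]

/-- `Γ(φ)` of a graph Hubbard Hamiltonian: hopping along the image bonds, repulsion on the image sites
(re-derivation of the plaquette file's identity, kept local). [cite: BratteliRobinsonII1997, §5.2.2] -/
private theorem fermionEmbed_hamiltonian_eq' (G₂ : SimpleGraph Λ₂) [DecidableRel G₂.Adj] (ψ : Λ₂ ↪ Λ₃) (t U : ℝ) :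
    fermionEmbed ψ (hamiltonian G₂ t U) =
      -(t : ℂ) • (∑ x : Λ₂, ∑ y : Λ₂, ∑ σ : Fin 2,
          if G₂.Adj x y then creation (orb (ψ x) σ) * annihilation (orb (ψ y) σ) else 0) +
        (U : ℂ) • ∑ x : Λ₂, numberOp (ψ x) 0 * numberOp (ψ x) 1 := by
  rw [hamiltonian, map_add, map_smul, map_smul, map_sum, map_sum]
  congr 2
  · refine Finset.sum_congr rfl fun x _ => ?_
    rw [map_sum]
    refine Finset.sum_congr rfl fun y _ => ?_
    rw [map_sum]
    refine Finset.sum_congr rfl fun σ _ => ?_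
    split_ifs
    · rw [map_mul, fermionEmbed_creation, fermionEmbed_annihilation]
    · rw [map_zero]
  · refine Finset.sum_congr rfl fun x _ => ?_
    rw [map_mul, fermionEmbed_numberOp, fermionEmbed_numberOp]

/-- **Cluster decomposition of a graph Hubbard Hamiltonian.** If the legs `φ_k` tile `Λ₃` (`(k, x) ↦ φ_k x` is a
bijection) and the bonds of `G` inside every leg are those of one graph `G₂` on `Λ₂`, then
`H_G(t, U) = Σ_k Γ_k(H_{G₂}(t, U)) + seam hopping`: the torus Hamiltonian is the decoupled sum of its open boxes plus
the bonds between boxes. [cite: Ruelle1969, §3.4] -/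
theorem hamiltonian_eq_decoupledSum_add_seamHopping (e : K × Λ₂ ≃ Λ₃) (he : ∀ k x, e (k, x) = φ k x)
    (G : SimpleGraph Λ₃) [DecidableRel G.Adj] (G₂ : SimpleGraph Λ₂) [DecidableRel G₂.Adj]
    (hG : ∀ k x y, G.Adj (φ k x) (φ k y) ↔ G₂.Adj x y) (t U : ℝ) :
    hamiltonian G t U = decoupledSum φ (hamiltonian G₂ t U) + seamHopping φ G t := by
  -- the decoupled sum, expanded
  have hdec : decoupledSum φ (hamiltonian G₂ t U) =
      -(t : ℂ) • (∑ k, ∑ x : Λ₂, ∑ y : Λ₂, ∑ σ : Fin 2,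
          if G₂.Adj x y then creation (orb (φ k x) σ) * annihilation (orb (φ k y) σ) else 0) +
        (U : ℂ) • ∑ k, ∑ x : Λ₂, numberOp (φ k x) 0 * numberOp (φ k x) 1 := by
    rw [decoupledSum]
    simp_rw [fermionEmbed_hamiltonian_eq']
    rw [Finset.sum_add_distrib, ← Finset.smul_sum, ← Finset.smul_sum]
  -- the torus hopping sum from one site `φ_k x`, split into the bonds inside the leg and the seam bonds
  have hsplit : ∀ (k : K) (x : Λ₂),
      (∑ q : Λ₃, ∑ σ : Fin 2, if G.Adj (φ k x) q then creation (orb (φ k x) σ) * annihilation (orb q σ) else 0) =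
        (∑ y : Λ₂, ∑ σ : Fin 2,
            if G₂.Adj x y then creation (orb (φ k x) σ) * annihilation (orb (φ k y) σ) else 0) +
          ∑ j, ∑ y : Λ₂, ∑ σ : Fin 2, if k ≠ j ∧ G.Adj (φ k x) (φ j y) then
            creation (orb (φ k x) σ) * annihilation (orb (φ j y) σ) else 0 := by
    intro k x
    rw [sum_eq_sum_sum_legs φ e he]
    have hterm : ∀ (j : K) (y : Λ₂) (σ : Fin 2),
        (if G.Adj (φ k x) (φ j y) then creation (orb (φ k x) σ) * annihilation (orb (φ j y) σ)
          else (0 : Matrix (Finset (Orb Λ₃)) (Finset (Orb Λ₃)) ℂ)) =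
          (if k = j ∧ G.Adj (φ k x) (φ j y) then creation (orb (φ k x) σ) * annihilation (orb (φ j y) σ) else 0) +
            (if k ≠ j ∧ G.Adj (φ k x) (φ j y) then creation (orb (φ k x) σ) * annihilation (orb (φ j y) σ)
              else 0) := by
      intro j y σ
      by_cases hkj : k = j
      · simp only [hkj, true_and, ne_eq, not_true_eq_false, false_and, if_false, add_zero]
      · simp only [hkj, false_and, if_false, ne_eq, not_false_eq_true, true_and, zero_add]
    simp_rw [hterm, Finset.sum_add_distrib]
    congr 1
    rw [Finset.sum_eq_single k]
    · simp_rw [true_and, hG]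
    · intro j _ hjk
      have hkj : ¬ (k = j) := fun h => hjk h.symm
      simp only [hkj, false_and, if_false, Finset.sum_const_zero]
    · intro h
      exact absurd (Finset.mem_univ k) h
  rw [hamiltonian, hdec, seamHopping, sum_eq_sum_sum_legs φ e he,
    sum_eq_sum_sum_legs φ e he (fun p : Λ₃ => numberOp p 0 * numberOp p 1)]
  simp_rw [hsplit, Finset.sum_add_distrib, smul_add]
  abel

/-- The seam hopping is Hermitian (it is the difference of two Hermitian Hamiltonians).
[cite: Ruelle1969, §3.4] -/
theorem isHermitian_seamHopping (e : K × Λ₂ ≃ Λ₃) (he : ∀ k x, e (k, x) = φ k x) (G : SimpleGraph Λ₃)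
    [DecidableRel G.Adj] (G₂ : SimpleGraph Λ₂) [DecidableRel G₂.Adj] (hG : ∀ k x y, G.Adj (φ k x) (φ k y) ↔ G₂.Adj x y)
    (t : ℝ) : (seamHopping φ G t).IsHermitian := by
  have h := hamiltonian_eq_decoupledSum_add_seamHopping φ e he G G₂ hG t 0
  have h' : seamHopping φ G t = hamiltonian G t 0 - decoupledSum φ (hamiltonian G₂ t 0) := by
    rw [h]; abel
  rw [h']
  exact (hamiltonian_isHermitian G t 0).sub (isHermitian_decoupledSum (hamiltonian_isHermitian G₂ t 0))

omit [DecidableEq K] in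
/-- **The particle number is a decoupled sum** over tiling legs: `N = Σ_k Γ_k(N₂)`. [cite: BratteliRobinsonII1997, §5.2.2] -/
theorem totalNumber_eq_decoupledSum (e : K × Λ₂ ≃ Λ₃) (he : ∀ k x, e (k, x) = φ k x) :
    (totalNumber : Matrix (Finset (Orb Λ₃)) (Finset (Orb Λ₃)) ℂ) = decoupledSum φ totalNumber := by
  rw [decoupledSum, totalNumber, sum_eq_sum_sum_legs φ e he]
  refine Finset.sum_congr rfl fun k _ => ?_
  rw [totalNumber, map_sum]
  refine Finset.sum_congr rfl fun x _ => ?_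
  rw [map_sum]
  exact Finset.sum_congr rfl fun σ _ => (fermionEmbed_numberOp (φ k) x σ).symm

omit [DecidableEq K] in
/-- **The spin imbalance is a decoupled sum** over tiling legs: `M = Σ_k Γ_k(M₂)`. [cite: BratteliRobinsonII1997, §5.2.2] -/
theorem spinImbalance_eq_decoupledSum (e : K × Λ₂ ≃ Λ₃) (he : ∀ k x, e (k, x) = φ k x) :
    (spinImbalance : Matrix (Finset (Orb Λ₃)) (Finset (Orb Λ₃)) ℂ) = decoupledSum φ spinImbalance := by
  rw [decoupledSum, spinImbalance, sum_eq_sum_sum_legs φ e he]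
  refine Finset.sum_congr rfl fun k _ => ?_
  rw [spinImbalance, map_sum]
  refine Finset.sum_congr rfl fun x _ => ?_
  rw [map_sub, fermionEmbed_numberOp, fermionEmbed_numberOp]

variable {φ}
  (hφ : ∀ k j, k ≠ j → Disjoint ((Finset.univ : Finset Λ₂).map (φ k)) ((Finset.univ : Finset Λ₂).map (φ j)))
include hφ

/-- **The seam hopping has zero expectation in the decoupled Gibbs state** of a `Θ`-even leg Hamiltonian: every seam
word `c†_{φ_k x,σ} c_{φ_j y,σ}`, `k ≠ j`, is odd on the leg `k`. [cite: ArakiMoriya2003, §4.1 eq. (4.8)] -/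
theorem gibbsState_decoupledSum_seamHopping {H : Matrix (Finset (Orb Λ₂)) (Finset (Orb Λ₂)) ℂ}
    (hH : parityAut H = H) (β : ℝ) (G : SimpleGraph Λ₃) [DecidableRel G.Adj] (t : ℝ) :
    Matrix.gibbsState β (decoupledSum φ H) (seamHopping φ G t) = 0 := by
  rw [seamHopping, map_smul]
  refine smul_eq_zero_of_right _ ?_
  rw [map_sum]
  refine Finset.sum_eq_zero fun k _ => ?_
  rw [map_sum]
  refine Finset.sum_eq_zero fun x _ => ?_
  rw [map_sum]
  refine Finset.sum_eq_zero fun j _ => ?_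
  rw [map_sum]
  refine Finset.sum_eq_zero fun y _ => ?_
  rw [map_sum]
  refine Finset.sum_eq_zero fun σ _ => ?_
  split_ifs with h
  · rw [← fermionEmbed_creation, ← fermionEmbed_annihilation]
    exact gibbsState_decoupledSum_fermionEmbed_mul_fermionEmbed hφ hH β h.1 (parityAut_creation _) _
  · exact map_zero _

end Seam

/-! ### §2 The rectangular torus cut into open boxes -/

section Blocks

variable {a b Kx Ky : ℕ}

/-- The first coordinate of a block site (unfolding `blockEmb`). [folklore] -/
private theorem blockEmb_fst_val' (i : Fin Kx) (j : Fin Ky) (p : Fin a ×ₗ Fin b) :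
    ((ofLex (blockEmb (A := Kx * a) (B := Ky * b) rfl rfl i j p)).1 : ℕ) = (i : ℕ) * a + (ofLex p).1 := rfl

/-- The second coordinate of a block site. [folklore] -/
private theorem blockEmb_snd_val' (i : Fin Kx) (j : Fin Ky) (p : Fin a ×ₗ Fin b) :
    ((ofLex (blockEmb (A := Kx * a) (B := Ky * b) rfl rfl i j p)).2 : ℕ) = (j : ℕ) * b + (ofLex p).2 := rfl

/-- Euclidean division on one axis: `i·a + u = i'·a + u'` with `u, u' < a` forces `i = i'` and `u = u'`. [folklore] -/
private theorem axis_inj' {i i' u u' : ℕ} (hu : u < a) (hu' : u' < a) (h : i * a + u = i' * a + u') :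
    i = i' ∧ u = u' := by
  have ha : 0 < a := by omega
  have e1 : (i * a + u) / a = i := by
    rw [Nat.mul_comm, Nat.mul_add_div ha, Nat.div_eq_of_lt hu, Nat.add_zero]
  have e2 : (i' * a + u') / a = i' := by
    rw [Nat.mul_comm, Nat.mul_add_div ha, Nat.div_eq_of_lt hu', Nat.add_zero]
  have hi : i = i' := by rw [← e1, h, e2]
  subst hi
  exact ⟨rfl, by omega⟩

/-- **The block map `((i,j), (x,y)) ↦ (i a + x, j b + y)` is injective** on `(blocks) × (box sites)` (the clusters of
the torus are disjoint). [cite: LeBlancEtAl2015, eq. (1)] -/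
theorem blockEmb_prod_injective :
    Function.Injective (fun z : (Fin Kx × Fin Ky) × (Fin a ×ₗ Fin b) =>
      blockEmb (A := Kx * a) (B := Ky * b) rfl rfl z.1.1 z.1.2 z.2) := by
  rintro ⟨⟨i, j⟩, p⟩ ⟨⟨i', j'⟩, p'⟩ h
  have h1 : (i : ℕ) * a + (ofLex p).1 = (i' : ℕ) * a + (ofLex p').1 := by
    have := congrArg (fun z : Fin (Kx * a) ×ₗ Fin (Ky * b) => ((ofLex z).1 : ℕ)) h
    simpa only [blockEmb_fst_val'] using this
  have h2 : (j : ℕ) * b + (ofLex p).2 = (j' : ℕ) * b + (ofLex p').2 := by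
    have := congrArg (fun z : Fin (Kx * a) ×ₗ Fin (Ky * b) => ((ofLex z).2 : ℕ)) h
    simpa only [blockEmb_snd_val'] using this
  obtain ⟨hi, hx⟩ := axis_inj' (ofLex p).1.isLt (ofLex p').1.isLt h1
  obtain ⟨hj, hy⟩ := axis_inj' (ofLex p).2.isLt (ofLex p').2.isLt h2
  have hp : p = p' := by
    have : ofLex p = ofLex p' := Prod.ext (Fin.ext hx) (Fin.ext hy)
    exact congrArg toLex this
  simp only [Prod.mk.injEq]
  exact ⟨⟨Fin.ext hi, Fin.ext hj⟩, hp⟩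

/-- **The blocks tile the torus**: `((i,j), p) ↦ blockEmb i j p` is a bijection
`(Fin K_x × Fin K_y) × (Fin a ×ₗ Fin b) ≃ Fin (K_x a) ×ₗ Fin (K_y b)`. [cite: LeBlancEtAl2015, eq. (1)] -/
def blockTilingEquiv : (Fin Kx × Fin Ky) × (Fin a ×ₗ Fin b) ≃ (Fin (Kx * a) ×ₗ Fin (Ky * b)) :=
  Equiv.ofBijective (fun z : (Fin Kx × Fin Ky) × (Fin a ×ₗ Fin b) =>
      blockEmb (A := Kx * a) (B := Ky * b) rfl rfl z.1.1 z.1.2 z.2)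
    ((Fintype.bijective_iff_injective_and_card _).2 ⟨blockEmb_prod_injective, by
      simp only [Fintype.card_prod, Fintype.card_fin, card_rectSites]
      ring⟩)

/-- **The block legs**: the `(i,j)`-th open `a × b` box of the `K_x a × K_y b` torus as an embedding of sites.
[cite: LeBlancEtAl2015, eq. (1)] -/
def blockLeg (ij : Fin Kx × Fin Ky) : (Fin a ×ₗ Fin b) ↪ (Fin (Kx * a) ×ₗ Fin (Ky * b)) :=
  ⟨fun p => blockEmb (A := Kx * a) (B := Ky * b) rfl rfl ij.1 ij.2 p, fun p q h => by
    have := blockEmb_prod_injective (a := a) (b := b) (Kx := Kx) (Ky := Ky) (a₁ := (ij, p)) (a₂ := (ij, q)) h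
    exact (Prod.ext_iff.1 this).2⟩

/-- Unfolding a block leg. [folklore] -/
private theorem blockLeg_apply (ij : Fin Kx × Fin Ky) (p : Fin a ×ₗ Fin b) :
    blockLeg (a := a) (b := b) ij p = blockEmb (A := Kx * a) (B := Ky * b) rfl rfl ij.1 ij.2 p := rfl

/-- The tiling equivalence is the block legs (on pairs). [cite: LeBlancEtAl2015, eq. (1)] -/
theorem blockTilingEquiv_apply (ij : Fin Kx × Fin Ky) (p : Fin a ×ₗ Fin b) :
    blockTilingEquiv (a := a) (b := b) (Kx := Kx) (Ky := Ky) (ij, p) = blockLeg ij p := rfl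

/-- **Different blocks are disjoint** (the open clusters of the torus). [cite: LeBlancEtAl2015, eq. (1)] -/
theorem disjoint_blockLeg (k j : Fin Kx × Fin Ky) (hkj : k ≠ j) :
    Disjoint ((Finset.univ : Finset (Fin a ×ₗ Fin b)).map (blockLeg (Kx := Kx) (Ky := Ky) k))
      ((Finset.univ : Finset (Fin a ×ₗ Fin b)).map (blockLeg j)) := by
  refine Finset.disjoint_left.2 fun z hz hz' => hkj ?_
  obtain ⟨p, -, rfl⟩ := Finset.mem_map.1 hz
  obtain ⟨q, -, h⟩ := Finset.mem_map.1 hz'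
  have := blockEmb_prod_injective (a := a) (b := b) (Kx := Kx) (Ky := Ky) (a₁ := (j, q)) (a₂ := (k, p)) h
  exact ((Prod.ext_iff.1 this).1).symm

/-- Orbital count: the torus has `K_x K_y` times the orbitals of a box. [cite: ArakiMoriya2003, §4.1] -/
theorem card_orb_rectTorus_eq_mul :
    Fintype.card (Orb (Fin (Kx * a) ×ₗ Fin (Ky * b))) =
      Fintype.card (Fin Kx × Fin Ky) * Fintype.card (Orb (Fin a ×ₗ Fin b)) := by
  simp only [Orb, Fintype.card_lex, Fintype.card_prod, Fintype.card_fin]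
  ring

/-- Inside a block the torus nearest-neighbour bonds are the open-box bonds (`K_x, K_y ≥ 2`).
[cite: LeBlancEtAl2015, eq. (1)] -/
theorem fermionRectTorusGraph_adj_blockLeg_iff (hKx : 2 ≤ Kx) (hKy : 2 ≤ Ky) (k : Fin Kx × Fin Ky)
    (x y : Fin a ×ₗ Fin b) :
    (fermionRectTorusGraph (Kx * a) (Ky * b)).Adj (blockLeg k x) (blockLeg k y) ↔ (rectBoxGraph a b).Adj x y := by
  rw [blockLeg_apply, blockLeg_apply, ← SimpleGraph.comap_adj (G := fermionRectTorusGraph (Kx * a) (Ky * b)),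
    comap_blockEmb_fermionRectTorusGraph' hKx hKy rfl rfl k.1 k.2]

/-- Inside a block the torus diagonal bonds are the open-box diagonal bonds (`K_x, K_y ≥ 2`).
[cite: LeBlancEtAl2015, eq. (1)] -/
theorem fermionRectTorusDiagGraph_adj_blockLeg_iff (hKx : 2 ≤ Kx) (hKy : 2 ≤ Ky) (k : Fin Kx × Fin Ky)
    (x y : Fin a ×ₗ Fin b) :
    (fermionRectTorusDiagGraph (Kx * a) (Ky * b)).Adj (blockLeg k x) (blockLeg k y) ↔
      (rectBoxDiagGraph a b).Adj x y := by
  rw [blockLeg_apply, blockLeg_apply, ← SimpleGraph.comap_adj (G := fermionRectTorusDiagGraph (Kx * a) (Ky * b)),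
    comap_blockEmb_fermionRectTorusDiagGraph' hKx hKy rfl rfl k.1 k.2]

/-- The open-box `t–t'` Hamiltonian preserves the spin sectors. [cite: LiebPRL1989, proof of Theorem 1] -/
private theorem preservesSectors_hubbardOpenBoxTT'_g10 (a b : ℕ) (t t' U : ℝ) :
    PreservesSectors (hubbardOpenBoxTT' a b t t' U) := by
  unfold hubbardOpenBoxTT'
  exact (preservesSectors_hamiltonian _ t U).add (preservesSectors_hamiltonian _ t' 0)

/-- `Θ M = M` for the spin imbalance `M = Σₓ (nₓ↑ − nₓ↓)`. [cite: ArakiMoriya2003, §4.1 Def. 4.2] -/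
theorem parityAut_spinImbalance {Λ : Type*} [LinearOrder Λ] [Fintype Λ] :
    parityAut (spinImbalance : Matrix (Finset (Orb Λ)) (Finset (Orb Λ)) ℂ) = spinImbalance := by
  rw [spinImbalance, map_sum]
  refine Finset.sum_congr rfl fun x _ => ?_
  rw [map_sub, numberOp, numberOp, map_mul, map_mul, parityAut_creation, parityAut_annihilation, parityAut_creation,
    parityAut_annihilation, neg_mul_neg, neg_mul_neg]

/-- The open-box grand-canonical Hamiltonian `H^open − μN − hM` is `Θ`-even. [cite: ArakiMoriya2003, §4.1 Def. 4.2] -/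
theorem parityAut_hubbardOpenBoxTT'_gc (a b : ℕ) (t t' U μ hz : ℝ) :
    parityAut (hubbardOpenBoxTT' a b t t' U - (μ : ℂ) • totalNumber - (hz : ℂ) • spinImbalance) =
      hubbardOpenBoxTT' a b t t' U - (μ : ℂ) • totalNumber - (hz : ℂ) • spinImbalance := by
  rw [map_sub, map_sub, map_smul, map_smul, parityAut_totalNumber, parityAut_spinImbalance,
    parityAut_eq_self_of_preservesSectors (preservesSectors_hubbardOpenBoxTT'_g10 a b t t' U)]

/-- **The grand-canonical `t–t'` torus Hamiltonian is the decoupled sum of its open boxes plus the seams**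
(`K_x, K_y ≥ 2`): `H^torus_{K_x a × K_y b} − μN − hM = Σ_{ij} Γ_{ij}(H^open_{a×b} − μN − hM) + (seam_t + seam_{t'})`.
[cite: Ruelle1969, §3.4] [cite: LeBlancEtAl2015, eq. (1)] -/
theorem hubbardRectTorusTT'_gc_eq_decoupledSum_add_seam (hKx : 2 ≤ Kx) (hKy : 2 ≤ Ky) (t t' U μ hz : ℝ) :
    hubbardRectTorusTT' (Kx * a) (Ky * b) t t' U - (μ : ℂ) • totalNumber - (hz : ℂ) • spinImbalance =
      decoupledSum (blockLeg (a := a) (b := b) (Kx := Kx) (Ky := Ky))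
          (hubbardOpenBoxTT' a b t t' U - (μ : ℂ) • totalNumber - (hz : ℂ) • spinImbalance) +
        (seamHopping blockLeg (fermionRectTorusGraph (Kx * a) (Ky * b)) t +
          seamHopping blockLeg (fermionRectTorusDiagGraph (Kx * a) (Ky * b)) t') := by
  have he : ∀ (k : Fin Kx × Fin Ky) (x : Fin a ×ₗ Fin b), blockTilingEquiv (k, x) = blockLeg k x := fun _ _ => rfl
  rw [hubbardRectTorusTT', hubbardOpenBoxTT', decoupledSum_sub, decoupledSum_sub, decoupledSum_smul, decoupledSum_smul,
    decoupledSum_add,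
    hamiltonian_eq_decoupledSum_add_seamHopping blockLeg blockTilingEquiv he (fermionRectTorusGraph (Kx * a) (Ky * b))
      (rectBoxGraph a b) (fermionRectTorusGraph_adj_blockLeg_iff hKx hKy) t U,
    hamiltonian_eq_decoupledSum_add_seamHopping blockLeg blockTilingEquiv he
      (fermionRectTorusDiagGraph (Kx * a) (Ky * b)) (rectBoxDiagGraph a b)
      (fermionRectTorusDiagGraph_adj_blockLeg_iff hKx hKy) t' 0,
    ← totalNumber_eq_decoupledSum blockLeg blockTilingEquiv he,
    ← spinImbalance_eq_decoupledSum blockLeg blockTilingEquiv he]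
  abel

/-- **The seams have zero mean in the decoupled grand-canonical Gibbs state of the boxes.**
[cite: ArakiMoriya2003, §4.1 eq. (4.8)] -/
theorem gibbsState_decoupledSum_openBox_seam (t t' U μ hz β : ℝ) :
    Matrix.gibbsState β (decoupledSum (blockLeg (a := a) (b := b) (Kx := Kx) (Ky := Ky))
        (hubbardOpenBoxTT' a b t t' U - (μ : ℂ) • totalNumber - (hz : ℂ) • spinImbalance))
      (seamHopping blockLeg (fermionRectTorusGraph (Kx * a) (Ky * b)) t +
        seamHopping blockLeg (fermionRectTorusDiagGraph (Kx * a) (Ky * b)) t') = 0 := by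
  rw [map_add, gibbsState_decoupledSum_seamHopping disjoint_blockLeg (parityAut_hubbardOpenBoxTT'_gc a b t t' U μ hz),
    gibbsState_decoupledSum_seamHopping disjoint_blockLeg (parityAut_hubbardOpenBoxTT'_gc a b t t' U μ hz), add_zero]

/-- **THE EXACT CLUSTER FLOOR, FINITE VOLUME.** For the `t–t'` Hubbard torus `ℤ/K_x aℤ × ℤ/K_y bℤ`, `K_x, K_y ≥ 2`, and
EVERY real `β, t, t', U, μ, h`:
`K_x K_y · log Re Tr e^{−β(H^open_{a×b} − μN − hM)} ≤ log Re Tr e^{−β(H^torus − μN − hM)}` —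
the product of the open-box grand-canonical Gibbs states is a trial state of the torus and the seams have zero mean
(Bogoliubov's tangent inequality). [cite: Ruelle1969, §3.4] [cite: Lieb1973, §V eqs. (5.2)–(5.4)] -/
theorem mul_log_partitionFn_openBox_gc_le_rectTorus_gc (hKx : 2 ≤ Kx) (hKy : 2 ≤ Ky) (t t' U μ hz β : ℝ) :
    (Kx * Ky : ℝ) *
        Real.log (partitionFn β (hubbardOpenBoxTT' a b t t' U - (μ : ℂ) • totalNumber - (hz : ℂ) • spinImbalance)).re ≤
      Real.log (partitionFn β (hubbardRectTorusTT' (Kx * a) (Ky * b) t t' U - (μ : ℂ) • totalNumber -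
        (hz : ℂ) • spinImbalance)).re := by
  set Kb := hubbardOpenBoxTT' a b t t' U - (μ : ℂ) • totalNumber - (hz : ℂ) • spinImbalance with hKb
  have hKbH : Kb.IsHermitian := isHermitian_sub_sub (hubbardOpenBoxTT'_isHermitian a b t t' U) μ hz
  have hKbE : parityAut Kb = Kb := parityAut_hubbardOpenBoxTT'_gc a b t t' U μ hz
  have hdecomp := hubbardRectTorusTT'_gc_eq_decoupledSum_add_seam (a := a) (b := b) hKx hKy t t' U μ hz
  set W := seamHopping (blockLeg (a := a) (b := b) (Kx := Kx) (Ky := Ky)) (fermionRectTorusGraph (Kx * a) (Ky * b)) t +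
    seamHopping blockLeg (fermionRectTorusDiagGraph (Kx * a) (Ky * b)) t' with hW
  have hWH : W.IsHermitian := by
    have he : ∀ (k : Fin Kx × Fin Ky) (x : Fin a ×ₗ Fin b), blockTilingEquiv (k, x) = blockLeg k x := fun _ _ => rfl
    exact (isHermitian_seamHopping blockLeg blockTilingEquiv he _ (rectBoxGraph a b)
      (fermionRectTorusGraph_adj_blockLeg_iff hKx hKy) t).add
      (isHermitian_seamHopping blockLeg blockTilingEquiv he _ (rectBoxDiagGraph a b)
        (fermionRectTorusDiagGraph_adj_blockLeg_iff hKx hKy) t')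
  have h0 : Matrix.gibbsState β (decoupledSum blockLeg Kb) W = 0 :=
    gibbsState_decoupledSum_openBox_seam (a := a) (b := b) (Kx := Kx) (Ky := Ky) t t' U μ hz β
  have h := (log_partitionFn_add_mem_Icc_of_gibbsState_eq_zero (isHermitian_decoupledSum hKbH) hWH β h0).1
  rw [log_partitionFn_decoupledSum disjoint_blockLeg hKbH hKbE card_orb_rectTorus_eq_mul β, Fintype.card_prod,
    Fintype.card_fin, Fintype.card_fin] at h
  rw [hdecomp]
  exact_mod_cast h

/-- **Square torus form**: `K² · log Re Ξ^open_ℓ ≤ log Re Ξ^torus_{Kℓ}` with the tree's square-torus grand-canonical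
Hamiltonian `gcTorusHamiltonianTT' (Kℓ)` (`K ≥ 2`, every real `β`). [cite: Ruelle1969, §3.4] -/
theorem sq_mul_log_partitionFn_openBox_gc_le_gcTorus {K ℓ : ℕ} (hK : 2 ≤ K) (t t' U μ hz β : ℝ) :
    (K : ℝ) ^ 2 *
        Real.log (partitionFn β (hubbardOpenBoxTT' ℓ ℓ t t' U - (μ : ℂ) • totalNumber - (hz : ℂ) • spinImbalance)).re ≤
      Real.log (partitionFn β (gcTorusHamiltonianTT' (K * ℓ) t t' U μ hz)).re := by
  rw [partitionFn_gcTorusHamiltonianTT'_re_eq_rect, sq]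
  exact mul_log_partitionFn_openBox_gc_le_rectTorus_gc (a := ℓ) (b := ℓ) hK hK t t' U μ hz β

end Blocks

/-! ### §3 Thermodynamic limit: `log Re Ξ^open_ℓ ≤ ℓ² · P` -/

section Limit

variable {β : ℝ} (hβ : 0 ≤ β) (t t' : ℝ) {U : ℝ} (hU : 0 ≤ U) (μ hz : ℝ)
include hβ hU

/-- **THE EXACT GRAND-CANONICAL CLUSTER FLOOR.** For `ℓ ≥ 1`, `β ≥ 0`, `U ≥ 0`:
`log Re Tr e^{−β(H^open_ℓ − μN − hM)} ≤ ℓ² · P(β; t,t',U; μ,h)` — the open-box grand-canonical pressure per site is a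
floor on the thermodynamic pressure, with no correction term (along the tori `L = Kℓ`: `K² log Re Ξ^open_ℓ ≤ log Re Ξ^torus_{Kℓ}`,
divide by `(Kℓ)²`, `K → ∞`). [cite: Ruelle1969, §3.4] [cite: Israel1979, Lemma II.3.1] [cite: Simon1993, §II.8] -/
theorem log_partitionFn_openBox_gc_le_sq_mul_gcPressure {ℓ : ℕ} (hℓ : 1 ≤ ℓ) :
    Real.log (partitionFn β (hubbardOpenBoxTT' ℓ ℓ t t' U - (μ : ℂ) • totalNumber - (hz : ℂ) • spinImbalance)).re ≤
      (ℓ : ℝ) ^ 2 * gcPressureTT'Zeeman β t t' U μ hz := by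
  set z : ℝ := Real.log (partitionFn β (hubbardOpenBoxTT' ℓ ℓ t t' U - (μ : ℂ) • totalNumber -
    (hz : ℂ) • spinImbalance)).re with hz_def
  set Ls : ℕ → ℕ := fun j => (j + 2) * ℓ with hLs_def
  have hLs : Tendsto Ls atTop atTop := by
    refine tendsto_atTop_mono (fun j => ?_) tendsto_id
    show j ≤ (j + 2) * ℓ
    nlinarith
  have hlim := tendsto_log_partitionFn_gcTorus_div_sq_comp hβ t t' hU μ hz hLs
  have hℓpos : (0 : ℝ) < ℓ := by exact_mod_cast hℓ
  have hle : ∀ j : ℕ, z / (ℓ : ℝ) ^ 2 ≤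
      Real.log (partitionFn β (gcTorusHamiltonianTT' (Ls j) t t' U μ hz)).re / ((Ls j : ℕ) : ℝ) ^ 2 := by
    intro j
    set K : ℕ := j + 2 with hK
    have hK2 : 2 ≤ K := by omega
    have hKpos : (0 : ℝ) < K := by positivity
    have h := sq_mul_log_partitionFn_openBox_gc_le_gcTorus (ℓ := ℓ) hK2 t t' U μ hz β
    have hLsj : Ls j = K * ℓ := by simp only [hLs_def, hK]
    rw [hLsj]
    have hcast : (((K * ℓ : ℕ) : ℝ)) ^ 2 = (K : ℝ) ^ 2 * (ℓ : ℝ) ^ 2 := by push_cast; ring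
    rw [hcast, div_le_div_iff₀ (by positivity) (by positivity)]
    calc z * ((K : ℝ) ^ 2 * (ℓ : ℝ) ^ 2) = (K : ℝ) ^ 2 * z * (ℓ : ℝ) ^ 2 := by ring
      _ ≤ Real.log (partitionFn β (gcTorusHamiltonianTT' (K * ℓ) t t' U μ hz)).re * (ℓ : ℝ) ^ 2 :=
        mul_le_mul_of_nonneg_right h (by positivity)
  have hfinal : z / (ℓ : ℝ) ^ 2 ≤ gcPressureTT'Zeeman β t t' U μ hz :=
    ge_of_tendsto hlim (Eventually.of_forall hle)
  have hℓ2 : (0 : ℝ) < (ℓ : ℝ) ^ 2 := by positivity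
  rwa [div_le_iff₀' hℓ2] at hfinal

/-- **Per-site form**: `ℓ⁻² log Re Ξ^open_ℓ ≤ P`. [cite: Ruelle1969, §3.4] -/
theorem log_partitionFn_openBox_gc_div_sq_le_gcPressure {ℓ : ℕ} (hℓ : 1 ≤ ℓ) :
    Real.log (partitionFn β (hubbardOpenBoxTT' ℓ ℓ t t' U - (μ : ℂ) • totalNumber - (hz : ℂ) • spinImbalance)).re /
        (ℓ : ℝ) ^ 2 ≤ gcPressureTT'Zeeman β t t' U μ hz := by
  have h := log_partitionFn_openBox_gc_le_sq_mul_gcPressure hβ t t' hU μ hz hℓ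
  have hℓpos : (0 : ℝ) < ℓ := by exact_mod_cast hℓ
  have hℓ2 : (0 : ℝ) < (ℓ : ℝ) ^ 2 := by positivity
  rwa [div_le_iff₀' hℓ2]

/-- **Certificate form**: a certified floor `w ≤ log Re Ξ^open_ℓ` on the open-box grand-canonical partition function
gives `w/ℓ² ≤ P`. [cite: Ruelle1969, §3.4] -/
theorem div_sq_le_gcPressure_of_le_log_partitionFn_openBox {ℓ : ℕ} (hℓ : 1 ≤ ℓ) {w : ℝ}
    (hw : w ≤ Real.log (partitionFn β (hubbardOpenBoxTT' ℓ ℓ t t' U - (μ : ℂ) • totalNumber -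
      (hz : ℂ) • spinImbalance)).re) :
    w / (ℓ : ℝ) ^ 2 ≤ gcPressureTT'Zeeman β t t' U μ hz := by
  have h := log_partitionFn_openBox_gc_div_sq_le_gcPressure hβ t t' hU μ hz hℓ
  have hℓpos : (0 : ℝ) < ℓ := by exact_mod_cast hℓ
  have hℓ2 : (0 : ℝ) < (ℓ : ℝ) ^ 2 := by positivity
  exact (div_le_div_of_nonneg_right hw hℓ2.le).trans h

/-- **Local-Hamiltonian form**: for the local grand-canonical Hamiltonian `K_{[0,ℓ)²}` of the infinite-volume
formalism, `log Re Tr e^{−βK_{[0,ℓ)²}} ≤ ℓ² · P` (`ℓ ≥ 1`, `β ≥ 0`, `U ≥ 0`). [cite: Israel1979, Lemma II.3.1] -/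
theorem log_partitionFn_gcLocalHamiltonianTT'_halfOpenBox_le_sq_mul {ℓ : ℕ} (hℓ : 1 ≤ ℓ) :
    Real.log (partitionFn β (gcLocalHamiltonianTT' (halfOpenBox 2 ℓ) t t' U μ hz)).re ≤
      (ℓ : ℝ) ^ 2 * gcPressureTT'Zeeman β t t' U μ hz := by
  rw [partitionFn_gcLocalHamiltonianTT'_halfOpenBox]
  exact log_partitionFn_openBox_gc_le_sq_mul_gcPressure hβ t t' hU μ hz hℓ

end Limit

/-! ### §4 The Gibbs variational upper bound without the logarithmic term -/

section Entropy

open Literature.InformationTheory.Entropy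

namespace InfVolFermionState

variable {β : ℝ} (hβ : 0 ≤ β) (t t' : ℝ) {U : ℝ} (hU : 0 ≤ U) (μ hz : ℝ) {ω : InfVolFermionState 2}
include hβ hU

/-- **Box entropies of a translation-invariant state against the pressure, sharp form** (`β ≥ 0`, `U ≥ 0`, `ℓ ≥ 1`):
`S(ω_{[0,ℓ)²}) ≤ ℓ²·(P(β;t,t',U;μ,h) + β·u(ω)) + β(8|t|+16|t'|)ℓ`, `u(ω) = e_Φ(ω) − μρ(ω) − h m(ω)` — Gibbs' inequality for
`ω_{B_ℓ}` and `K_{B_ℓ}`, then the EXACT open-box pressure bound (no `2 log(ℓ²+1)`).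
[cite: Israel1979, Lemma II.3.1] [cite: ArakiMoriya2003, Theorem 3.8 and §10] -/
theorem IsTranslationInvariant.vonNeumannEntropy_rdm_halfOpenBox_le_sharp (hω : ω.IsTranslationInvariant) {ℓ : ℕ}
    (hℓ : 1 ≤ ℓ) :
    vonNeumannEntropy (ω.rdm (halfOpenBox 2 ℓ)) ≤
      (ℓ : ℝ) ^ 2 * (gcPressureTT'Zeeman β t t' U μ hz +
          β * (ω.meanEnergy (hubbardTTPrimeFermionInteraction t t' U) 1 - μ * ω.density -
            hz * ((ω.expect ({0} : Finset (Site 2)) (nAt 0 (mem_singleton_self 0) 0)).re -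
              (ω.expect ({0} : Finset (Site 2)) (nAt 0 (mem_singleton_self 0) 1)).re))) +
        β * ((8 * |t| + 16 * |t'|) * ℓ) := by
  set B := halfOpenBox 2 ℓ with hB
  set K := gcLocalHamiltonianTT' B t t' U μ hz with hK
  have hGibbs := (gcLocalHamiltonianTT'_isHermitian B t t' U μ hz).vonNeumannEntropy_sub_mul_le_log_partitionFn β
    (ω.rdm_posSemidef B) (ω.trace_rdm B)
  rw [trace_rdm_mul] at hGibbs
  have hZ := log_partitionFn_gcLocalHamiltonianTT'_halfOpenBox_le_sq_mul hβ t t' hU μ hz hℓ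
  have hE := hω.re_expect_gcLocalHamiltonianTT'_halfOpenBox_le t t' U μ hz ℓ
  have hβE := mul_le_mul_of_nonneg_left hE hβ
  rw [← hB, ← hK] at hZ hE hβE
  nlinarith [hGibbs, hZ, hβE]

/-- **Per-site form with the sharp rate**: for every translation-invariant `ω` and `ℓ ≥ 1`,
`S(ω_{[0,ℓ)²})/ℓ² ≤ P + β·u(ω) + β(8|t|+16|t'|)/ℓ`. [cite: Israel1979, Lemma II.3.1] -/
theorem IsTranslationInvariant.vonNeumannEntropy_rdm_halfOpenBox_div_sq_le_sharp (hω : ω.IsTranslationInvariant)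
    {ℓ : ℕ} (hℓ : 1 ≤ ℓ) :
    vonNeumannEntropy (ω.rdm (halfOpenBox 2 ℓ)) / (ℓ : ℝ) ^ 2 ≤
      gcPressureTT'Zeeman β t t' U μ hz +
          β * (ω.meanEnergy (hubbardTTPrimeFermionInteraction t t' U) 1 - μ * ω.density -
            hz * ((ω.expect ({0} : Finset (Site 2)) (nAt 0 (mem_singleton_self 0) 0)).re -
              (ω.expect ({0} : Finset (Site 2)) (nAt 0 (mem_singleton_self 0) 1)).re)) +
        β * (8 * |t| + 16 * |t'|) / ℓ := by
  have h := hω.vonNeumannEntropy_rdm_halfOpenBox_le_sharp hβ t t' hU μ hz hℓ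
  have hℓpos : (0 : ℝ) < ℓ := by exact_mod_cast hℓ
  have hℓ2 : (0 : ℝ) < (ℓ : ℝ) ^ 2 := by positivity
  rw [div_le_iff₀ hℓ2]
  have e : (gcPressureTT'Zeeman β t t' U μ hz +
          β * (ω.meanEnergy (hubbardTTPrimeFermionInteraction t t' U) 1 - μ * ω.density -
            hz * ((ω.expect ({0} : Finset (Site 2)) (nAt 0 (mem_singleton_self 0) 0)).re -
              (ω.expect ({0} : Finset (Site 2)) (nAt 0 (mem_singleton_self 0) 1)).re)) +
        β * (8 * |t| + 16 * |t'|) / ℓ) * (ℓ : ℝ) ^ 2 =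
      (ℓ : ℝ) ^ 2 * (gcPressureTT'Zeeman β t t' U μ hz +
          β * (ω.meanEnergy (hubbardTTPrimeFermionInteraction t t' U) 1 - μ * ω.density -
            hz * ((ω.expect ({0} : Finset (Site 2)) (nAt 0 (mem_singleton_self 0) 0)).re -
              (ω.expect ({0} : Finset (Site 2)) (nAt 0 (mem_singleton_self 0) 1)).re))) +
        β * ((8 * |t| + 16 * |t'|) * ℓ) := by
    field_simp
  rw [e]
  exact h

end InfVolFermionState

end Entropy

end Literature.MathematicalPhysics.QuantumLattice

end
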